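import Mathlib
import HarnessLib
import HarnessLib.Audit
import Summits.CriticalPhenomena.Statement
import Literature.Probability.Percolation.TriInterfaceSLE
import Literature.Probability.RandomPlanarGeometry.LoewnerDescription
import Literature.Probability.RandomPlanarGeometry.SLEConvergenceCriterion
import Literature.Probability.RandomPlanarGeometry.HexSAW
import Literature.Probability.RandomPlanarGeometry.TiltedExplorer
import Literature.Probability.RandomPlanarGeometry.ChordalCurveFamily
import Literature.Probability.RandomPlanarGeometry.CrossingCondition
import Literature.Probability.RandomPlanarGeometry.LatticeFlowLinePassage
import Literature.Probability.RandomPlanarGeometry.TriBoundaryWinding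
import HarnessLib.Audit.Status.Attr

/-!
Route: SAWTiltedExplorer

DORMANT since 2026-08-25T12:35:34Z (reconciler: no traction for 7.7 d (last activity item-evidence-added at 2026-08-17T19:14:41Z); parked, not closed — `ledger route dormant route-CriticalPhenomena-SAWTiltedExplorer --off` to reactivate) — unstaffed, not closed; items shared with open routes are served there. `ledger route dormant <id> --off` reactivates.

# Route SAWTiltedExplorer — the tilted harmonic explorer — an annealed kappa = 8/3 flow line with
exact lattice martingales, tuned by one gap constant, as the SAW's kinetic twin

It suffices to show X = (E) ∧ (K) ∧ (U), realising card tilted-harmonic-explorer (the PROCESS for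
which the imaginary-geometry harmonic
function is an exact lattice martingale). Setting: hexagonal lattice δHex in a Dobrushin domain (Ω;
a, b) with admissible discrete two-arc
data E_δ (G02's `DiscreteDobrushin`, arcs A left / B right of the path); hexagons = sites of δ𝕋;
boundary data β_δ on the two discrete arcs
approximating the κ = 8/3 imaginary-geometry boundary function 𝔥₀ = 3/2 − (3/π)·arg φ⁻¹ + (1/π)·arg
φ'∘φ⁻¹ (units λ' = 1: λ = 3/2,
χ = 1/π, χ/λ = 2/(3π) ⇔ κ = 4 − 2πχ/λ = 8/3). The TILTED HARMONIC EXPLORER THE(g): colour the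
undetermined hexagon v ahead of the tip
so that E[value revealed at v | past] = H_t(v), the discrete harmonic extension (SRW on hexagon
centres absorbed on arcs and on coloured
hexagons) of the current data, where a hexagon coloured at step t is frozen with the value (A_t −
π/2)/π ∓ g (A_t = unwrapped
absolute angle of the dart along which the path first passes it, − on the left bank, + on the right
bank, g the lattice gap); the
turn probability is affine in H_t(v), clamped to [0, 1]; the path is G02's exploration interface of
the resulting colouring, a
simple lattice curve from a_δ to b_δ, and M_t(z) := H_t(z) is an EXACT martingale at every hexagon z
off clamping (Schramm–Sheffield's
first-step argument, verbatim). (E) ExplorerSLE: for some lattice gap g* (g* = 1 if nothing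
renormalises; the zigzag bias of the
first-passage rule predicts g* ≈ 5/6) the interface law of THE(g*) converges in every Dobrushin
domain to chordal SLE_{8/3}, via:
clamping defect → 0 (TiltedExplorerMartingale, rank 2), Kemppainen–Smirnov regularity
(TiltedExplorerRegular, rank 6), passage of the
lattice martingale to the continuum imaginary-geometry functional (HarmonicWindingPassage, rank 4)
and the martingale characterisation
of SLE_{8/3} (WindingMartingaleIdentification, rank 7, typed). (K) KineticTwinHex (rank 3): the
hexagonal x_c-SAW law and the THE(g*)
interface law in the same discrete domains are asymptotically equal on bounded continuous
functionals of the curve. (U)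
LatticeUniversality (rank 5, typed, the shared item of route SAWHexUniversality): ℤ² x_c-SAW ≈
hexagonal x_c-SAW. Then the ℤ²
conjunct follows in one line (two-ε). Typed today: (U), the identification (rank 7), the
boundary-data construction and the typed
shell TwinShell (∃ an exploration-interface comparison family converging to SLE_{8/3} and
asymptotically equal to the ℤ² SAW), which
(E) ∧ (K) ∧ (U) instantiate with μ_δ := THE(g*) colouring measure; the explorer-specific cruxes of
(E) (ranks 2, 4, 6) stay informal until restated
against the landed definitions D1 (tilted explorer colouring measure) and D2 (lattice flow-line
harmonic functional); (K) = r3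
KineticTwinHex is typed (rev 4) with (c, g, β) pinned by the convergence of the explorer interface
family to SLE_{8/3}.
Lean: `TwinShell`

## Assembly
TwinShell → SAWScalingLimit is two-ε bookkeeping: ConvergesInLawToSLE for the interfaces gives an
SLE_{8/3} curve Γ with TendstoLaw
interface μ Γ; adding the vanishing difference of test integrals gives TendstoLaw for the SAW curve
laws; a.e.-measurability of the SAW
observable is automatic (`SAW.aemeasurable_curve`); hence ConvergesInLawToSLE (8/3) for the ℤ² SAW,
i.e. the conjunct. TwinShell itself
is instantiated (layer 2, after D1/D2) by E_δ := an admissible discretisation oriented so that G02's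
exploration starts at a (for the
opposite orientation of ∂D use the flipped marked domain: `IsSLECurve` depends only on carrier and
marked points), μ_δ := THE(g*)
colouring with boundary data from BoundaryWindingData, (E) = TiltedExplorerMartingale →
TiltedExplorerRegular → HarmonicWindingPassage
→ WindingMartingaleIdentification, and (K) + (U) for the closeness clause (hexagonal endpoints: ANY
`IsEmbEndpointApprox` family (a'_δ, b'_δ), decoupled from the explorer's outer A–B faces, whose
centres may
leave Ω — restated KineticTwinHex, rev 4).

Rationale: WHY THIS LINE. Schramm–Sheffield's harmonic explorer (SchrammSheffield2005, arXiv:math/0310210)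
turned SLE₄ into a theorem by asking each step to keep
the discrete harmonic measure honest; the martingale only needs the coin to be affine in the
harmonic extension, not constant data, so
tilting the DATA by the path's own winding with the imaginary-geometry constants of
MillerSheffield2016 (IG I, arXiv:1201.1496, Thm 1.1:
flow-line values ∓λ' + χ·winding, 2πχ = (4 − κ)λ; IG IV arXiv:1302.4738 §3.6: θ_c = 2π exactly at κ
= 8/3, the 'seamless' value where a
full turn shifts the data by the gap) keeps an EXACT lattice martingale while κ moves to 8/(2 + 3c)
for tilt c (c = 1/3 ↔ 8/3); no
Gaussian field is sampled (the annealed cousin of a flow line, as HE is the annealed DGFF level line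
of SchrammSheffield2009) and the
identification engine is the bosonic martingale observable that MakarovSmirnov2010 §1.1 print for
every κ. Imported areas: imaginary
geometry / GFF flow lines (probability), discrete potential theory on rough slit domains
(Chelkak2016, KemppainenSmirnov2017 §4 which
verifies Condition G2 for the harmonic explorer), Laplacian-growth physics with an explicit
dictionary (growth probability affine in a
harmonic field of winding data). Versus prior routes: SAWLaplacianWalk tilts by (harmonic measure of
the TARGET)^{5/8} with no exact
martingale; SAWParafermion / SAWResidueField need a discrete-holomorphic SAW observable (barrier
ParafermionicHalfCauchyRiemann);
SAWHexUniversality quarantines DCS Conjecture 1 whole — here the hexagonal conjecture is split into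
a lattice-native SLE_{8/3}
construction (E) plus a same-lattice coupling statement (K); versus the negatives index, every
statement is eventual in δ. Found while
typing (recorded in NUMBERS): the first-passage freezing rule biases the effective gap by +πχ/6, so
the card's literal constants give
SLE_{κ'}(ρ; ρ) with κ' = 2.8, ρ = −0.1 by the IG dictionary; one real parameter (the lattice gap g)
must be tuned, exactly as the level-line
height λ of SchrammSheffield2009 is lattice-dependent — χ (macroscopic winding response) and λ
(boundary data) do not renormalise, so the
tuned member is forced to κ = 8/3 with ρ = 0.

RANKED CRUXES. Ranked cruxes of the line (2 = most informative): r2 TiltedExplorerMartingale was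
filed informal at open (text in
§ Two-layer plan; refuter verdict 2026-08-15: substantive — bulk clamping of the exact coin) and
awaits its re-draw as the
homogenisation crux delivering hypothesis (ii) of r4; r4 is TYPED (rev 14, 2026-08-15) as
HarmonicWindingPassageR in its second
repair C″: the texture-free lattice IG functional with the CANONICALLY (radially) UNWRAPPED
centred-window bank angle
Θ_h(i₀) = A_{i₀} + Σ_{m<h} pv(arg(c_{i₀+2+m} − c_{i₀−m−1}) − arg(c_{i₀+1+m} − c_{i₀−m})) (refuter's
Repair.lean `centredWindowAngleC`,
inlined by `let`), replacing C′ over `centredWindowAngle` (refuted-misstated, SHEET LEAK: the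
representative nearest to the local dart
angle reverts to the first-passage rule along h_δ → ∞, DuplantierBinder2002 winding spread) which
replaced HarmonicWindingPassage
stmt-8293 (refuted-misstated, backward-window bias); statement: KS-regular (event form) interface
family + tested near-martingale of
the C-functional at (c, g) = (1/3, 1) ⇒ every subsequential limit has the far-field flow-line
identities of r7; r6 is RESTATED (rev 11–12, 2026-08-15) as
TiltedExplorerKSRegular (stmt-13918): the a-priori KS regularity of THE(1/3, g_δ), g_δ ∈ [1/2, 3/2],
with boundary data pinned by
definition D3 `triBoundaryWinding` and two-chain hygiene, stated by its mesh-robust OUTPUT (tight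
along the mesh + every probability
subsequential limit a.e. Loewner-describable with W₀ = 0, source a) — informal until D3 lands, typed
template in the crux workfiles /
evidence (Sketch.lean rc 0); it replaces TiltedExplorerRegularR (stmt-13924, refuted-misstated M4:
the unforced part computed in
D.carrier ∖ γ leaves a sub-mesh gate at a_δ) and absorbs the former support ExplorerKSTransfer
(stmt-13940, same hypothesis), because
every fixed-mesh continuum Condition G2 for hexagonal exploration curves is false or vacuous (the
refuter's ksDomain repair puts b_δ off the
closure — whiskers point outward, unforcedPart = ∅, Lean-checked; any polygon domain keeping the arc
hexagons has the boundary-contact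
underpass artefact of SAWParafermion's KSConditionG2 audit);
typed: r3 KineticTwinHex (rev 4), r5 LatticeUniversality (shared), r7
WindingMartingaleIdentification, and the support items.
#5 LatticeUniversality (crux) — (U; identical to route SAWHexUniversality's item
stmt-CriticalPhenomena-0807, shared) for every Dobrushin domain, every ℤ² endpoint approximation
(a_δ, b_δ) and every hexagonal endpoint approximation (a'_δ, b'_δ), ∫ f∘curve dP^{ℤ²}_{x_c(ℤ²),δ} −
∫ f∘curve dP^{Hex}_{x_c(Hex),δ} → 0 for every bounded continuous f on CurveClass ℂ. Here it carries
the explorer (a hexagonal object) to the ℤ² conjunct; the alternative (a 3-move tilted explorer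
directly on the faces of δℤ², solving the two linear martingale equations for (p_left, p_straight,
p_right)) is recorded under Not decomposed yet. [difficulty: open-problem] (why it might fail:
Uniform ℤ² SAW is in no Yang–Baxter/integrable family and no SAW coupling across lattices exists;
lattice effects persist in boundary ensembles (KennedyLawler2013); needs tightness of both walks,
open.) [GlazmanManolescu2019, KennedyLawler2013, DuminilCopinSmirnov2012,
Literature.Barriers.CriticalPhenomena.NienhuisWeightsExcludeVertexSAW]
#7 WindingMartingaleIdentification (crux) — (martingale characterisation of SLE_{8/3} by the
imaginary-geometry harmonic function; the continuum engine shared with cards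
imaginary-geometry-winding-dirichlet r4 and turn-defect-kernel-orthogonality) let φ : ℍ → D be
chordal uniformizing and ν a probability law on curve classes, ν-a.e. Loewner-describable through φ
with driving function W, W₀ = 0, started at a. For w ∈ ℍ put Z_t = g_t(w) − W_t and N^w_t :=
−(3/π)(arg Z_t − arg w) + (2/π)∫₀ᵗ Im(Z_s⁻²) ds (= 𝔥_t(φ(w)) − 𝔥₀(φ(w)) in units λ' = 1: 2λ/π = 3/π,
2χ = 2/π; the φ' terms cancel in increments), stopped at τ^{w,m} = inf{t : |W_t| ≥ m or |Z_t| ≤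
1/(m+1)} ∧ m. If for some R and all w with |w| > R the stopped N^{w,m} satisfy the martingale
cylinder identities under ν (integrable, E[(N_{t∧τ} − N_{s∧τ}) ψ(W_{s₁..s_n})] = 0), then ν is the
chordal SLE_{8/3} law in D. Proof route: far field N = (3/π)Im(1/w)·W_t + (3/2π)Im(w⁻²)·(W_t² −
(8/3)t) + O(|w|⁻³) uniformly under the stopping ⇒ W^{τ_m} and (W² − 8t/3)^{τ_m} martingales ⇒ Lévy ⇒
`isSLELaw_of_isLocalMartingale_driving` with the κ ≠ 8 trace facts. [difficulty: L] (why it might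
fail: As typed, c ↦ g_t(w) and τ^{w,m} must be measurable for the Integrable clause (else the
hypothesis is unsatisfiable and the item vacuous); the far-field expansion needs the whole sector
|w| > R (granted); W₀ = 0 + describability must supply Lévy's filtration.) [SchrammSheffield2005,
MakarovSmirnov2010, MillerSheffield2016, arXiv:1201.1496, Lawler2005]
#9 BoundaryWindingData (support) — (the boundary half of the data; construction) for every Dobrushin
domain D and every admissible hexagonal discretisation family E_δ (domain D, mesh δ, eventually
admissible, start face → a, end face → b) there are boundary data β_δ on the two discrete arcs such
that for every chordal uniformizing φ there is a continuous branch θ of arg φ'∘φ⁻¹ on D with (i) the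
discrete harmonic extension H0^δ[β_δ] (SRW on Ω_δ ⊆ δ𝕋 absorbed on the arcs) converging to 𝔥₀ = 3/2
− (3/π) arg φ⁻¹ + θ/π uniformly on compacts, with H0^δ[β_δ²] locally bounded (uniform
integrability), and (ii) the start gauge: π·(β_δ(x_a) + β_δ(y_b))/2 − θ(first examined hexagon) → 0
for the two hexagons x_a ∈ A, y_b ∈ B of the first crossed edge. Intended witness: the
lattice-intrinsic boundary winding read off the two boundary-hugging exploration paths (all-closed /
all-open configurations), vector-averaged at a mesoscopic scale (the naive side-angle average is
biased by lattice anisotropy, e.g. 9.16° for a boundary tilted by 10°); fallback witness: β_δ :=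
samples of 𝔥₀ near the arcs. [difficulty: M] [MillerSheffield2016, Chelkak2016,
SchrammSheffield2005]
#9 TwinShell (support) — (typed shell of X, the shape the informal cruxes instantiate with μ_δ :=
the THE(g*) colouring measure on data E_δ) for every Dobrushin domain and ℤ² endpoint approximation
there are discrete hexagonal Dobrushin data E_δ and probability measures μ_δ on hexagon colourings
whose G02 exploration interfaces `triInterfaceIn D (E δ)` converge in law to chordal SLE_{8/3} in D
(this is (E)) and whose test integrals differ from those of the ℤ² x_c-SAW law by o(1) (this is (K)
∧ (U)). As typed (∃) it carries no difficulty by itself (any SLE_{8/3}-convergent lattice-path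
family works if the conjunct holds); it fixes the explorer shape of the assembly. [difficulty:
provable-now] [SchrammSheffield2005, CamiaNewman2007, LawlerSchrammWerner2004SAW]

TWO-LAYER PLAN. Informal cruxes filed right after open (need D1/D2; signatures by set-signature when
the definitions land):
r2 TiltedExplorerMartingale — there is a lattice gap g* such that for THE(g*) with boundary data as
in BoundaryWindingData, in every
Dobrushin domain, the total clamping defect E Σ_{t<T_ρ(z)} |E[H_{t+1}(z) − H_t(z) | F_t]| → 0 for
every interior z (T_ρ = first approach
of the tip within ρ of z), and g ↦ (effective gap) is continuous so that g* exists by intermediate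
values; why it might fail: lattice-scale
near-returns are frequent, each clamped step costs overshoot × harmonic measure and there are
δ^{-4/3+o(1)} steps; the effective gap may
depend on more than one texture statistic (then no single g works and (λ_lat, g) must both be
tuned); sources SchrammSheffield2005 §3–4,
MillerSheffield2016 Thm 1.1, SchrammSheffield2009 (lattice-dependent λ).
r3 KineticTwinHex (TYPED, rev 4) — for every (c_δ, g_δ, E_δ, β_δ) at which the THE interface law
converges to chordal
SLE_{8/3} in D (the tuned explorer of (E)) and every hexagonal endpoint approximation (a'_δ, b'_δ),
∫ F∘curve dP^{Hex-SAW}_δ − ∫ F∘interface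
dμ_δ → 0 for bounded continuous F (intended proof: coupling of the two tip-Markov chains, or the
defect identity of card
turn-defect-kernel-orthogonality; foreseen split K ⇐ K1 (kernel defect → 0 in L¹ under the SAW law)
∧ K2 (defect → 0 ⇒ equality);
modulo (E), K is DCS Conjecture 1 in coupling form — Sketch lemmas attached to the item);
why it might fail: it is the universality statement — the kernels differ at O(1) per step, only a
coarse-grained coupling can work, and
the SAW may simply not be an IG flow line with unrenormalised (χ, λ); sources arXiv:math/0204277 §4,
KennedyLawler2013, Kennedy2004.
r4 HarmonicWindingPassageR (TYPED, rev 14, C″) — ∀ D, E_δ (carrier, mesh, eventually admissible,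
start/finish faces → a/b),
β_δ, h_δ → ∞ with h_δ δ → 0, eventually-probability μ_δ, chordal φ, branch θ with
IsBoundaryWindingDatum D φ E β θ: (i) IsKSRegularAlongMesh
of the interfaces and (ii) IsTestedNearMartingaleAt E μ (Ĥ^C(ζ_δ)) z ρ for every interior z, ρ > 0,
ζ_δ → z — Ĥ^C_n = absorbed SRW
extension on Ω_δ of (β_δ on the arcs; bank hexagon first passed by dart i₀: (1/3)(Θ − π/2)/(π/3) ∓
1, Θ the canonically unwrapped
centred-window direction Θ_{h_δ}(i₀) once the forward half-window is explored, the provisional dart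
angle A_{i₀} before) ⇒ every
probability subsequential limit ν has HasFarFieldFlowLineIdentities D φ ν (= r7's hypothesis block
verbatim); why it might fail: Θ is
sheet-exact but a scale-h_δδ CHORD direction, and the continuum bank datum is χ·arg f_t′ (the
equipotential direction): a side-odd
hm-conditional mean of their difference at exposed bank points would shift the bank gap ⇒
SLE_κ'(ρ'); sources Chelkak2016,
KemppainenSmirnov2017, SchrammSheffield2005 §4 Prop 3/Lemma 4, MillerSheffield2016 Thm 1.1/2.4,
CDHKSCRAS2014 §3, DuplantierBinder2002,
Pommerenke1992 Thm 6.18 (McMillan). Dead wordings: first-passage draft (micro-texture, NUMBERS),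
stmt-8293 (backward window) and C′
stmt-14169 (anchored centred window: sheet leak), both refuted-misstated.
r6 TiltedExplorerKSRegular (restated rev 11–12; replaces TiltedExplorerRegular stmt-8294 →
TiltedExplorerRegularR stmt-13924, both
refuted-misstated, and absorbs ExplorerKSTransfer stmt-13940) — for THE(1/3, g_δ), g_δ ∈ [1/2, 3/2],
with boundary data
triBoundaryWinding (D3: −3/2 + (Â − π)/π on arc A, +3/2 + Â/π on arc B, Â the centred-window
direction of the boundary-hugging
exploration path, zero gauge; wall offsets ∓(5/3 − g), repulsive), window m_δ → ∞, m_δ δ → 0, on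
clean two-chain admissible
discretisations of D started at a and finished at b: (T) the interface family triInterfaceIn D (E δ)
under tiltedExplorerMeasure is
tight along the mesh and (L) for every chordal uniformizing φ every probability subsequential limit
ν is ν-a.e. Loewner-describable with
drivingFunction φ c 0 = 0 and c.source = a. Intended proof: a LATTICE-INTRINSIC conditional hitting
estimate à la Schramm–Sheffield
§6.2 Prop. 9 (D_n := union of the closed hexagons undetermined at time n; if no component of B(z,R)
∩ D_n touches determined hexagons of
both colours then P(γ[n,N] meets B(z,r) | F_n) ≤ K (r/R)^Δ for ρ_δ ≤ r ≤ R, ρ_δ → 0), attached by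
provers with --supports, then the
proofs of KS17 Thm 1.5/Cor 1.7–1.8 and AB99 in the interface polygon domains U_δ → D; why it might
fail: clamping on lattice pockets has
positive density (refuter 8291) and the data are unbounded, so the SS05 stopping argument must be
made uniform over pasts without HE's
monotone {0,1} data; sources KemppainenSmirnov2017 Thm 1.5, Def 2.3, Rem 2.10, §4.1.3–4.1.4, §4.3;
SchrammSheffield2005 §6.2–6.4;
AizenmanBurchard1999. (Why no G2 item: with U = D.carrier the start a_δ is a sub-mesh gate (M4);
with U = the bounded component cut by
the two hugging exploration curves a_δ, b_δ lie one whisker OUTSIDE the closure, so `Disconnects` is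
vacuous and the unforced part empty;
with U = any polygon domain containing the arc hexagons a past sliding along arc B to within r of
b_δ and walling inwards > R makes the
annulus component behind the wall lattice-forced yet continuum-unforced through the contact hexagon
— conditional probability 1.)
Foreseen glued splits (k ≤ 3, depth 1): TwinShell ⇐ ExplorerSLE → KineticTwinHex →
LatticeUniversality (glue: two-ε + endpoint /
orientation bookkeeping); ExplorerSLE ⇐ TiltedExplorerMartingale ∧ TiltedExplorerKSRegular →
HarmonicWindingPassageR →
WindingMartingaleIdentification (glue: `convergesInLawToSLE_of_isTightAlongMesh` pattern of
TriInterfaceSLE.lean with BoundaryWindingData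
supplying β). OPEN BOOKKEEPING for tenure: HarmonicWindingPassageR's hypothesis (i) is
`IsKSRegularAlongMesh` (event form through
approximating uniformizers φ_δ of the polygon domains U_δ), stronger than r6's (T)+(L); a support
transfer '(lattice estimate) ⇒
IsKSRegularAlongMesh' (KS17 Prop 3.2/Thms 3.9–3.10 + Radó-type convergence φ_δ → φ, needing the
polygon domains to be Jordan) is the
next support item for tenure (D3 `triBoundaryWinding` has LANDED, TriBoundaryWinding.lean, and r4 is
typed as of rev 14; r6's signature
can now be set from its D3 template). Caveat for r6/D3: `triBoundaryWinding` uses the ANCHORED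
`centredWindowAngle 0 P m i`; on the
hugging paths a sheet slip needs a fold-back of the discrete arc by more than a half turn inside one
window — harmless for
piecewise-smooth ∂D, to be re-examined for rough Jordan boundaries.

KILL CRITERIA. ¬TiltedExplorerMartingale in its simulation form — no gap g ∈ [1/2, 3/2] at which the
fitted (κ̂, ρ̂) of THE(g) passes through
(8/3, 0), or a clamping defect that does not decay with δ — closes the route
`refuted:TiltedExplorerMartingale` (the explorer is then not
an SLE_{8/3} generator at all). KineticTwinHex refuted (macroscopic statistics of tuned THE and of
pivot-sampled hexagonal SAWs disagree
beyond error, or a theorem separating the two limits) closes the route while (E) survives as a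
GFF-free lattice construction of
SLE_{8/3} for the Literature. ¬LatticeUniversality closes this route and SAWHexUniversality together
and is major evidence about the
conjunct itself. ¬WindingMartingaleIdentification as typed = a mis-typing (measurability / stopping)
⇒ restate, not a pivot. HexConjecture
(stmt-0808) proved elsewhere moots (E) ∧ (K) as a path to the conjunct (close `superseded`), not the
explorer theorem.

NOT DECOMPOSED YET. The definitions D1/D2 and everything inside them (coin, clamping bookkeeping,
hugging-path boundary winding, mesoscopic window); the
renormalisation map g ↦ (κ'(g), ρ(g)) = (4 − 2πχ/(g_eff + πχ/2), λ/(g_eff + πχ/2) − 1) and whether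
one parameter suffices; the gauge at
rough prime ends (θ = arg φ' oscillating at a: the lattice anchors its branch on β's two start
hexagons); the endpoint-orientation flip of
D; measurability of prefix functionals; the interior version and its self-avoidance dichotomy at κ ≤
8/3 (laboratory, IG IV §3.6); the
3-move square-lattice explorer (two linear martingale equations + normalisation for three moves)
that would remove (U); the 4.8.8 variant;
any use of the explorer for SAW tightness. All are layer-2 children or definition work, filed only
after a crux closes or D1 lands.

CHEAPEST FALSIFIER. Simulation (the refuter's first kit job; compute-free hub, not run here): THE(g)
on the hexagonal lattice in a 2000-hexagon-wide
rectangle / half-strip with straight lattice-aligned boundary (β constant ∓3/2 there, no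
boundary-winding subtlety), tilt c = 1/3, gaps
g ∈ {2/3, 5/6, 1, 7/6}: estimate κ̂ from Schramm's left-passage formula at interior points and from
the driving-function variance after a
discrete Loewner transform (Kennedy2004's method), ρ̂ from the law of the first boundary contact
side/asymmetry, and record clamping
frequency × mean overshoot as δ halves. Predictions to shoot at: first-passage rule at g = 1 gives
(κ̂, ρ̂) ≈ (2.8, −0.1), at g = 5/6
≈ (8/3, 0); if no g in range gives 8/3 within error, or the defect does not decay, rank 2 is dead.
Second, cheaper still: exact
enumeration of the zigzag/corner statistics E_hm[r] of THE paths at small sizes fixes the predicted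
g* before any SLE fit.

NUMBERS. Units λ' = 1: λ = 3/2, χ = 1/π, tilt c := (π/3)χ/λ' = 1/3, bank data k/3 ∓ g with k the
hexagonal winding index (60° units);
κ(c) = 8/(2 + 3c): c = 0 ↔ 4 (HE), 1/3 ↔ 8/3, 2/3 ↔ 2; seamless identity 2πχ = 2λ' ⇔ κ = 8/3 (IG IV
§3.6: θ_c = πκ/(4 − κ) = 2π).
General effective gap g_eff: λ_f = g_eff + πχ/2 = g_eff + 1/2, κ' = 4 − 2/λ_f, ρ = (3/2)/λ_f − 1 (IG
I Thm 1.1 with mismatched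
boundary data); first-passage rule: g_eff = g + 1/6 (zigzag bias πχ/6) ⇒ at g = 1: λ_f = 5/3, κ' =
2.8, ρ = −0.1; bisector rule:
g_eff = g + (1/6)(E_hm[r] − 2) with r the number of consecutive darts passing a bank hexagon.
x_c(Hex) = 1/√(2+√2)
(DuminilCopinSmirnov2012 Thm 1); 2.6 ≤ μ(ℤ²) ≤ 2.7. Items at open: 5 typed (2 cruxes, 2 support, 1
assembly) + 4 informal cruxes.

DEFINITION REQUESTS. D1 `tiltedExplorerMeasure (E : DiscreteDobrushin) (β : Site 2 → ℝ) (c g : ℝ) :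
Measure (SiteConfig (Site 2))` — the colouring law
of the tilted harmonic explorer (coin clamp((f_R − H_t(v))/(f_R − f_L)) for 'v open', f_{R/L} = ±g +
c·(k_{t−1} ± 1) + (A₀ − π/2)/π in
the gauge anchored on β, unexplored hexagons fair coins), topic
Literature/Probability/RandomPlanarGeometry (next to the harmonic
explorer, which is the case c = 0, g = 1, β = ∓1); D2 `latticeFlowLineHarmonic` — the discrete
harmonic extension H_n(ζ) of
(β on arcs, bank rule on passed hexagons) for a face sequence, with the first-passage rule (exact
martingale of D1) and the
mesoscopic-window rule (texture-free, for HarmonicWindingPassage), same topic; cite-facts wanted: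
Schramm–Sheffield 2005 Thm 1.1 / Prop.
(HE → SLE₄, exact martingale) and Miller–Sheffield IG I Thm 1.1 (flow lines of GFF with boundary
data −λ(1+ρ^L), λ(1+ρ^R) are
SLE_κ(ρ^L; ρ^R)) as Literature named facts.

Novelty: Searches (2026-08-15): `lit galaxy search "harmonic explorer" --star all` (23 rows: Lawler's book,
Katori, Grimmett RCM; pdf: Gruzberg
review, Rohde's Schramm survey, CamiaNewman2007, Kang–Makarov 2111.10057, Duminil-Copin parafermion
notes, Tizdast et al. 2105.02694
modified Loewner forces, Müller-Lohmann thesis, Beneš LERW slides, Karrila arXiv:2208.06008 pairing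
probabilities — none tilts the DATA
by winding); `lit galaxy search --star pdf "imaginary geometry flow line lattice"` (0) and `"flow
lines of the Gaussian free field"` (3,
LQG/Brownian map, irrelevant); `lit frontier CriticalPhenomena --since 2020` (30 rows; SAW:
arXiv:2310.17299 sub-ballisticity only;
explorer: 2208.06008); `lit bridges CriticalPhenomena --cross any` (nothing on explorers); `lit
search` / `--hybrid` cascade rc 75
(searchd unavailable at filing — the card's audit had read SchrammSheffield2005 pp. 3, 14–15 and
MakarovSmirnov2010 p. 3);
`ledger negatives` (1 item, stmt-0772). Library: no harmonic explorer, GFF or flow line in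
Literature (lean search).
Nearest prior art found: SchrammSheffield2005 (arXiv:math/0310210: exact harmonic martingale ⇒ SLE₄;
'variants' = other lattices /
Markov chains, all κ = 4); MakarovSmirnov2010 §1.1 (arXiv:0909.5377: bosonic martingale observable
for every κ; massive HE = the other
known tilt, off-critical); MillerSheffield2016 Thm 1.1 and IG IV arXiv:1302.4738 §3.6 (continuum
flow lines, constants, θ_c(8/3) = 2π;
p. 6 of IG I: discretised flow lines 'not proved'); Sch  [refs: 2208.06008, 2310.17299, math/0310210, 0909.5377, 1302.4738, CamiaNewman2007, SchrammSheffield2005, MakarovSmirnov2010, MillerSheffield2016, SchrammSheffield2009]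

Barriers (technique_class: tilted-harmonic-explorer, exact-harmonic-martingale): - technique_class: tilted-harmonic-explorer, exact-harmonic-martingale
- Literature.Barriers.CriticalPhenomena.SAWNotKineticallyGrown: engaged and evaded exactly as the
harmonic explorer evades it for κ = 4 — the growth rule is NON-local (it reads the harmonic
extension over the whole determined region, the barrier's own `evasions_known`), so locality/κ = 6
does not follow, and THE is never claimed to BE the SAW at finite mesh (the barrier's theorem
concerns consistency of uniform SAW measures); equality is claimed only in the limit, as crux
KineticTwinHex.
- Literature.Barriers.CriticalPhenomena.NienhuisWeightsExcludeVertexSAW: not met — no exact vertex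
relation or observable on ℤ² is posited (`not_hasExactVertexRelationZ2` untouched); the only exactly
harmonic object is the killed SRW expectation, discrete-harmonic on every lattice by construction;
the ℤ² walk enters through the asymptotic statement (U).
- Literature.Barriers.CriticalPhenomena.ParafermionicHalfCauchyRiemann: not met — no parafermionic
observable, no half Cauchy–Riemann identity; winding sits in Dirichlet DATA of a harmonic function,
not in a phase.
- Literature.Barriers.CriticalPhenomena.EmbeddingModulusUniqueness: the line is embedding-aware
(conformal structure comes from the random walk / harmonic measure of the honestly embedded
honeycomb lattice, the exempted SS05 / LSW class); on a sheared embedding THE(g) is a different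
process with the sheared walk's harmonic measure.
- Literature.Barriers.CriticalP

History (route lifecycle, newest last):
- 2026-08-15T16:55:17Z · rev 3: restated BoundaryWindingData (stmt-CriticalPhenomena-8023) — repair (route-review note on stmt-8023, SUSPECT-FALSE as typed): restate BoundaryWindingData 1:1 dropping ONLY the uniform-integrability conjunct (exists M, eve (planner-rbadge-CriticalPhenomena-SAWTiltedExpl-70379fc9-g2-0)
- 2026-08-15T21:21:56Z · rev 4: restated KineticTwinHex (stmt-CriticalPhenomena-8292) — repair: KineticTwinHex (stmt-CriticalPhenomena-8292) refuted-misstated by refuter rattack gen-1/gen-2 (W.lean KTHProbe.not_twinLitAt / KTH2.not_twinLitAt: pinne (planner-rrefute-CriticalPhenomena-SAWTiltedExp-72186141-0)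
- 2026-08-15T21:36:35Z · rev 6: dropped stmt-CriticalPhenomena-13926 — drop accidental duplicate of TiltedExplorerRegularR (stmt-CriticalPhenomena-13924 is the intended item; a second workitem add with identical informal text creat (planner-rrefute-CriticalPhenomena-SAWTiltedExp-ac4e9079-0)
- 2026-08-15T21:38:08Z · rev 7: dropped stmt-CriticalPhenomena-8294 — repair: TiltedExplorerRegular (stmt-CriticalPhenomena-8294) refuted-misstated by refuter rattack gen-0/gen-2 (M1 tilt quantifier: only c=1/3 is compatible with (planner-rrefute-CriticalPhenomena-SAWTiltedExp-ac4e9079-0)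
- 2026-08-15T21:49:19Z · rev 10: dropped stmt-CriticalPhenomena-8293 — repair: drop the refuted-misstated informal HarmonicWindingPassage (stmt-CriticalPhenomena-8293, backward-window bias, refuter rattack 8293-0) — replaced at ran (planner-rrefute-CriticalPhenomena-SAWTiltedExp-b0d673d8-0)
- 2026-08-15T23:10:10Z · rev 12: dropped stmt-CriticalPhenomena-13924, stmt-CriticalPhenomena-13940 — repair r6: TiltedExplorerRegularR (stmt-13924) refuted-misstated M4 by refuter rattack-13924-0 (EVIDENCE.md + W.lean 22:39Z: unforced part computed in D.carrier (planner-rrefute-CriticalPhenomena-SAWTiltedExp-0c378db3-0)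
- 2026-08-15T23:50:17Z · rev 14: restated HarmonicWindingPassageR (stmt-CriticalPhenomena-14169) — repair r4 (second): HarmonicWindingPassageR stmt-CriticalPhenomena-14169 refuted-misstated by refuter rattack-14169-0 (SHEET LEAK of the anchored `centredWindow (planner-rrefute-CriticalPhenomena-SAWTiltedExp-96c16e35-0)
- 2026-08-25T12:35:34Z · DORMANT — reconciler: no traction for 7.7 d (last activity item-evidence-added at 2026-08-17T19:14:41Z); parked, not closed — `ledger route dormant route-CriticalPhenomen (operator:999:3913245)

sub-problem: SAWScalingLimit · status: dormant · opened planner-plancard-CriticalPhenomena-SAWScaling-bd87be62-0 2026-08-15T12:25:10Z · rev 14 · ledger route-CriticalPhenomena-SAWTiltedExplorer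
GENERATED by the gate from the ledger (D-0016/17). Provers cite these decls: `theorem foo : Summit.CriticalPhenomena.SAWScalingLimit.Theses.SAWTiltedExplorer.<Decl> := …` in Summits/CriticalPhenomena/SAWScalingLimit/Theorems/<Name>.lean.
-/

namespace Summit.CriticalPhenomena.SAWScalingLimit.Theses.SAWTiltedExplorer

open scoped BigOperators Topology Manifold Classical MeasureTheory ProbabilityTheory Matrix InnerProductSpace ComplexConjugate ContinuousMap
open Filter Set Function TopologicalSpace MeasureTheory

attribute [summit_statement] _root_.SAWScalingLimit

-- item stmt-CriticalPhenomena-8291 · crux · rank 2 · open · by planner — informal only, no Lean statement yet: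
--   [crux] (E, part 1: the tilted harmonic explorer is an asymptotically exact martingale generator;
--   needs definitions D1 tiltedExplorerMeasure and D2 latticeFlowLineHarmonic) There is a lattice gap g*
--   ∈ ℝ such that for the tilted harmonic explorer THE(c = 1/3, g*) on the hexagonal lattice — coin: the
--   undetermined hexagon v ahead of the tip is coloured 'open/left' with probability clamp((f_R −
--   H_t(v))/(f_R − f_L)), f_R = g* + (A_{t−1} + π/3 − π/2)/π, f_L = −g* + (A_{t−1} − π/3 − π/2)/π,
--   A_{t−1} the unwrapped absolute angle of the incoming dart in the gauge anchored on the boundary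
--   data, H_t the di

-- earlier KineticTwinHex (stmt-CriticalPhenomena-8292, replaced 2026-08-15T21:21:56Z -> stmt-CriticalPhenomena-13825): retired by None — [crux] (K, the conjunct link; needs D1) For every Dobrushin domain D, every admissible hexagonal discretisation family E_δ started at a, boundary data β_δ as in BoundaryWindingData and the tuned gap g* of TiltedExplorerMartingale: with μ_δ := the THE(1/3, g*) colou
/-- item stmt-CriticalPhenomena-13825 · crux · rank 3 · open · by planner
why it might fail: Modulo (E) it is DCS Conjecture 1 in coupling form (Sketch.lean: HexConj => K; K + one convergent explorer family => HexConj in D): the SAW tip kernel x_c*Z-ratio and the affine-harmonic coin differ at O(1) per step, no tip-chain coupling is known, hex-SAW tightness is open.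
sources: LawlerSchrammWerner2004SAW, arXiv:math/0204277, DuminilCopinSmirnov2012, KennedyLawler2013, arXiv:1109.3091, Kennedy2004
[crux] (K, the conjunct link — RESTATED 2026-08-15 after the refuted-misstated verdicts on the
informal wording: M1 the SAW endpoints were pinned to the explorer's outer A–B faces, whose centres
leave D.carrier frequently (hexSAWLaw junk 0; W.lean KTHProbe/KTH2.not_twinLitAt); M2 'the tuned gap
g* of TiltedExplorerMartingale' / 'β as in BoundaryWindingData' were dangling definite
descriptions.) For every mesh-indexed tilt c_δ and gap g_δ, every Dobrushin domain D, every
hexagonal discretisation family E_δ of D (domain D.carrier, mesh δ, eventually admissible) and arc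
data β_δ such that the interface law of the tilted harmonic explorer THE(c_δ, g_δ) — colouring law
μ_δ := tiltedExplorerMeasure (E δ) (β δ) (c δ) (g δ) (D1, landed), interface triInterfaceIn D (E δ)
— CONVERGES IN LAW TO CHORDAL SLE_{8/3} IN D (the conclusion of (E) at the tuned parameters: this
pins (c, g, β) with no reference to another item's ∃-witness, and is robust to the pending
restatements of TiltedExplorerMartingale / TiltedExplorerRegular / HarmonicWindingPassage), and for
EVERY hexagonal endpoint approximation (a'_δ, b'_δ) of (a, b) (any IsEmbEndpointApprox hexGraph
hexCenter family, decoupled from the explo -/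
@[route_item "route-CriticalPhenomena-SAWTiltedExplorer"]
def KineticTwinHex : Prop :=
  ∀ (c g : ℝ → ℝ) (D : Literature.Probability.RandomPlanarGeometry.DobrushinDomain) (E : ℝ → Literature.Probability.LatticeModels.DiscreteDobrushin) (β : ℝ → Literature.Probability.LatticeModels.Site 2 → ℝ), (∀ δ, (E δ).Ω = D.carrier) → (∀ δ, (E δ).δ = δ) → (∀ᶠ δ in nhdsWithin (0 : ℝ) (Set.Ioi 0), (E δ).IsAdmissible) → Literature.Probability.RandomPlanarGeometry.ConvergesInLawToSLE ((8 : NNReal) / 3) D (Ωδ := fun _ => Literature.Probability.Percolation.SiteConfig (Literature.Probability.LatticeModels.Site 2)) (fun δ => Literature.Probability.Percolation.triInterfaceIn D (E δ)) (fun δ => Literature.Probability.RandomPlanarGeometry.tiltedExplorerMeasure (E δ) (β δ) (c δ) (g δ)) → ∀ (a' b' : ℝ → Literature.Probability.LatticeModels.HexVertex), Literature.Probability.RandomPlanarGeometry.SAW.IsEmbEndpointApprox Literature.Probability.LatticeModels.hexGraph Literature.Probability.LatticeModels.hexCenter D a' b' → ∀ F : BoundedContinuousFunction (Literature.Probability.RandomPlanarGeometry.CurveClass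 ℂ) ℝ, Filter.Tendsto (fun δ => (∫ γ, F γ.curve ∂(Literature.Probability.RandomPlanarGeometry.SAW.hexSAWLaw D.carrier δ (a' δ) (b' δ))) - ∫ ω, F (Literature.Probability.Percolation.triInterfaceIn D (E δ) ω) ∂(Literature.Probability.RandomPlanarGeometry.tiltedExplorerMeasure (E δ) (β δ) (c δ) (g δ))) (nhdsWithin 0 (Set.Ioi 0)) (nhds 0)

-- earlier HarmonicWindingPassageR (stmt-CriticalPhenomena-14169, replaced 2026-08-15T23:50:17Z -> stmt-CriticalPhenomena-13996): retired by None — [crux] (E, part 3: passage of the texture-free lattice IG functional — REPAIRED C′ replacing HarmonicWindingPassage stmt-CriticalPhenomena-8293, refuted-misstated by refuter rattack 8293-0: the one-sided backward window is biased by ±b = O(1) on the banks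
/-- item stmt-CriticalPhenomena-13996 · crux · rank 4 · open · by planner
why it might fail: Θ is sheet-exact but still a scale-h_δδ CHORD direction: the hm-conditional mean of (chord direction − equipotential direction arg f_t′) at exposed bank points must vanish side by side; an O(1) side-odd mean shifts the bank gap ⇒ identities of SLE_κ'(ρ'), κ' ≠ 8/3; and 3rd-order texture bias.
sources: Chelkak2016, arXiv:1212.6205, KemppainenSmirnov2017, arXiv:1212.6215, SchrammSheffield2005, arXiv:math/0310210
[crux] (E, part 3: passage of the texture-free lattice IG functional — C″, SECOND repair. History:
HarmonicWindingPassage stmt-8293 refuted-misstated (one-sided backward window biased ±b on rough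
banks); C′ = stmt-14169 (first wording of this decl, over `centredWindowAngle` of
LatticeFlowLinePassage.lean) refuted-misstated by refuter rattack-14169-0, SHEET LEAK:
`centredWindowAngle` picks the representative of the scale-h chord direction NEAREST to the local
first-passage dart angle A_{i₀}, so Â − Θ_canonical = 2π·round(Δ/2π), Δ = lattice-vs-scale-h
relative winding, whose hm-law spreads like (6/25) ln h (DuplantierBinder2002) with a side-odd
first-passage offset ω = ∓(r−1)π/6 ⇒ along h_δ → ∞ the anchored rule reverts to D2's first-passage
rule ((κ',ρ') ≈ (2.8,−0.1) at g = 1; leak ≈ 8 % at h = 256–512 and growing,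
EVIDENCE_14169_sheet_leak.md). REPAIR = the refuter's Repair.lean `centredWindowAngleC`, inlined
here by `let` with the argument order of `latticeFlowLineHarmonicCentred` (Sketch.lean rc 0; Iff.rfl
against the named form): the bank angle is the CANONICAL RADIAL UNWRAPPING Θ_h(i₀) = A_{i₀} +
Σ_{m<h} pv(θ_{m+1} − θ_m), θ_m = arg(c_{i₀+1+m} − c_{i₀−m}) the chord over the 2m+ -/
@[route_item "route-CriticalPhenomena-SAWTiltedExplorer"]
def HarmonicWindingPassageR : Prop :=
  ∀ (D : Literature.Probability.RandomPlanarGeometry.DobrushinDomain) (E : ℝ → Literature.Probability.LatticeModels.DiscreteDobrushin) (β : ℝ → Literature.Probability.LatticeModels.Site 2 → ℝ) (hw : ℝ → ℕ) (μ : ℝ → Measure (Literature.Probability.Percolation.SiteConfig (Literature.Probability.LatticeModels.Site 2))) (φ : Literature.Probability.RandomPlanarGeometry.ConformalEquiv UpperHalfPlane.upperHalfPlaneSet D.carrier) (θ : ℂ → ℝ), let ends : Literature.Probability.LatticeModels.DiscreteDobrushin → Literature.Probability.LatticeModels.HexVertex × Literature.Probability.LatticeModels.HexVertex := fun E' =>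 match Literature.Probability.LatticeModels.explorationWalk E' ∅ with | some γ => (γ.1, γ.2.1) | none => (((0 : Literature.Probability.LatticeModels.Site 2), (0 : Fin 2)), ((0 : Literature.Probability.LatticeModels.Site 2), (0 : Fin 2))); let angC : (Literature.Probability.LatticeModels.Site 2 → ℝ) → (ℕ → Literature.Probability.LatticeModels.HexVertex) → ℕ → ℕ → ℝ := fun β' P k i => Literature.Probability.RandomPlanarGeometry.dartAngle β' P i + ∑ m ∈ Finset.range k, (((Complex.arg (Literature.Probability.LatticeModels.hexCenter (P (i + 2 + m)) - Literature.Probability.LatticeModels.hexCenter (P (i - (m + 1)))) - Complex.arg (Literature.Probability.LatticeModels.hexCenter (P (i + 1 + m)) - Literature.Probability.LatticeModels.hexCenter (P (i - m))) : ℝ) : Real.Angle)).toReal; let HC : Literature.Probability.LatticeModels.DiscreteDobrushin → (Literature.Probability.LatticeModels.Site 2 → ℝ) → ℝ → ℝ → ℕ → ℕ → (ℕ → Literature.Probability.LatticeModels.HexVertex) → Literature.Probability.LatticeModels.Site 2 → ℝ := fun E' β' c g k n P => Literature.Probability.RandomPlanarGeometry.triHitExtension (Literature.Probability.LatticeModels.triDiscreteDomainGraph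 E'.Ω E'.δ) (Literature.Probability.RandomPlanarGeometry.flowLineAbsorbing E' P n) (fun u => if u ∈ E'.triArcA ∪ E'.triArcB then β' u else c * (((if Literature.Probability.RandomPlanarGeometry.firstPassage P u + k < n then angC β' P k (Literature.Probability.RandomPlanarGeometry.firstPassage P u) else Literature.Probability.RandomPlanarGeometry.dartAngle β' P (Literature.Probability.RandomPlanarGeometry.firstPassage P u)) - Real.pi / 2) / (Real.pi / 3)) + (if Literature.Probability.RandomPlanarGeometry.IsLeftOfDart P (Literature.Probability.RandomPlanarGeometry.firstPassage P u) u then -g else g)); D.IsChordalUniformizing φ → ((∀ δ, (E δ).Ω = D.carrier) ∧ (∀ δ, (E δ).δ = δ) ∧ (∀ᶠ δ in 𝓝[>] 0, (E δ).IsAdmissible) ∧ Tendsto (fun δ : ℝ => (δ : ℂ) * Literature.Probability.LatticeModels.hexCenter (ends (E δ)).1) (𝓝[>] 0) (𝓝 (D.pt 0)) ∧ Tendsto (fun δ : ℝ => (δ : ℂ) * Literature.Probability.LatticeModels.hexCenter (ends (E δ)).2) (𝓝[>] 0) (𝓝 (D.pt 1))) → (∀ᶠ δ in 𝓝[>] 0,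 IsProbabilityMeasure (μ δ)) → Tendsto hw (𝓝[>] 0) atTop → Tendsto (fun δ => (hw δ : ℝ) * δ) (𝓝[>] 0) (𝓝 0) → Literature.Probability.RandomPlanarGeometry.IsBoundaryWindingDatum D φ E β θ → Literature.Probability.RandomPlanarGeometry.IsKSRegularAlongMesh D φ (Ωδ := fun _ => Literature.Probability.Percolation.SiteConfig (Literature.Probability.LatticeModels.Site 2)) (fun δ => Literature.Probability.Percolation.triInterfaceIn D (E δ)) μ → (∀ z ∈ D.carrier, ∀ ρ : ℝ, 0 < ρ → ∀ ζ : ℝ → Literature.Probability.LatticeModels.Site 2, Tendsto (fun δ => Literature.Probability.LatticeModels.triMeshPoint δ (ζ δ)) (𝓝[>] 0) (𝓝 z) → Literature.Probability.RandomPlanarGeometry.IsTestedNearMartingaleAt E μ (fun δ n P => HC (E δ) (β δ) (1 / 3) 1 (hw δ) n P (ζ δ)) z ρ) → ∀ ν : Measure (Literature.Probability.RandomPlanarGeometry.CurveClass ℂ), IsProbabilityMeasure ν → Literature.Probability.RandomPlanarGeometry.IsSubseqLimitLaw (Ωδ := fun _ => Literature.Probability.Percolation.SiteConfig (Literature.Probability.LatticeModels.Site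 2)) (fun δ => Literature.Probability.Percolation.triInterfaceIn D (E δ)) μ ν → Literature.Probability.RandomPlanarGeometry.HasFarFieldFlowLineIdentities D φ ν

/-- item stmt-CriticalPhenomena-0807 · crux · rank 5 · open · by planner
why it might fail: Uniform ℤ² SAW is in no Yang–Baxter/integrable family and no SAW coupling across lattices exists; lattice effects persist in boundary ensembles (KennedyLawler2013); needs tightness of both walks, open.
sources: GlazmanManolescu2019, KennedyLawler2013, DuminilCopinSmirnov2012, Literature.Barriers.CriticalPhenomena.NienhuisWeightsExcludeVertexSAW
[crux] r2 (hardest, most informative; informal until defn HexSAWLaw lands): lattice universality of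
the chordal critical SAW law — for every Dobrushin domain (Ω; a, b), every square-lattice endpoint
approximation (a_δ, b_δ) (Literature.Probability.RandomPlanarGeometry.SAW.IsEndpointApprox) and
every hexagonal-lattice endpoint approximation (a'_δ, b'_δ), and every bounded continuous f on
CurveClass ℂ: ∫ f∘curve dP^{Z^2}_{x_c(Z^2),δ} − ∫ f∘curve dP^{Hex}_{x_c(Hex),δ} → 0 as δ → 0+
(x_c(Hex) = 1/√(2+√2), Duminil-Copin–Smirnov 2012 Thm 1). Tool: Yang–Baxter track exchange on
rhombic tilings (Glazman–Manolescu arXiv:1708.00395 §3), which so far controls boundary two-point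
functions, not curve laws. -/
@[route_item "route-CriticalPhenomena-SAWTiltedExplorer"]
def LatticeUniversality : Prop :=
  ∀ (D : Literature.Probability.RandomPlanarGeometry.DobrushinDomain) (a b : ℝ → Literature.Probability.LatticeModels.Site 2) (a' b' : ℝ → Literature.Probability.LatticeModels.HexVertex), Literature.Probability.RandomPlanarGeometry.SAW.IsEndpointApprox D a b → Literature.Probability.RandomPlanarGeometry.SAW.IsEmbEndpointApprox Literature.Probability.LatticeModels.hexGraph Literature.Probability.LatticeModels.hexCenter D a' b' → ∀ f : BoundedContinuousFunction (Literature.Probability.RandomPlanarGeometry.CurveClass ℂ) ℝ, Filter.Tendsto (fun δ => (∫ γ, f γ.curve ∂(Literature.Probability.RandomPlanarGeometry.SAW.law D.carrier δ (a δ) (b δ))) - ∫ γ, f γ.curve ∂(Literature.Probability.RandomPlanarGeometry.SAW.hexSAWLaw D.carrier δ (a' δ) (b' δ))) (nhdsWithin 0 (Set.Ioi 0)) (nhds 0)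

/-- item stmt-CriticalPhenomena-13918 · crux · rank 6 · open · by planner
why it might fail: Coin clamps on lattice pockets with positive density (refuter 8291: ~1% of steps) and winding data are unbounded: the SS05 Prop 9 stopping argument must be uniform over pasts with clamping drift, without HE's monotone {0,1} data; KS/AB99 transfer must run from the lattice-intrinsic estimate.
sources: KemppainenSmirnov2017, arXiv:1212.6215, SchrammSheffield2005, arXiv:math/0310210, AizenmanBurchard1999, MillerSheffield2016
[crux] (E, part 2 — a-priori Kemppainen–Smirnov regularity of the tilted explorer, RESTATED by its
mesh-robust output. Replaces stmt-13924 (refuted-misstated M4: unforced part computed in D.carrier∖γ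
leaves a sub-mesh gate at a_δ) and absorbs the support ExplorerKSTransfer stmt-13940 (same
G2-in-D.carrier hypothesis). Why not the refuter's C‴ (ksDomain = bounded complementary component of
the two hugging exploration curves, target b_δ): both whiskers [a_δ,f₁], [f_{N−1},b_δ] of that loop
point OUTWARD (outer AB faces), so b_δ ∉ closure(ksDomain) ⇒ Disconnects is vacuous ⇒ unforcedPart =
∅ ⇒ C‴ is trivially true (Sketch.lean: unforcedCrossingEvent_eq_empty_of_not_mem_closure, proved);
and in ANY polygonal lattice domain that keeps the arc hexagons the continuum slit domain has a
one-hexagon underpass below every boundary contact of the past (SAWParafermion's KSConditionG2 audit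
witness transposes: slide along arc B to a contact q with |q − b_δ| < r, then a wall of length > R
into the interior; in A(q;r,R) the component east of the wall is crossed by EVERY lattice
continuation (the west side is a lattice dead end at q) yet does not disconnect tip from b_δ in U∖γ
(path under q through -/
@[route_item "route-CriticalPhenomena-SAWTiltedExplorer"]
def TiltedExplorerKSRegular : Prop :=
  ∀ (D : Literature.Probability.RandomPlanarGeometry.DobrushinDomain) (E : ℝ → Literature.Probability.LatticeModels.DiscreteDobrushin) (m : ℝ → ℕ) (g : ℝ → ℝ), let start : Literature.Probability.LatticeModels.DiscreteDobrushin → Literature.Probability.LatticeModels.HexVertex := fun E => match Literature.Probability.LatticeModels.explorationWalk E (∅ : Set (Literature.Probability.LatticeModels.Site 2)) with | some γ => γ.1 | none => (((0 : Literature.Probability.LatticeModels.Site 2), (0 : Fin 2)) : Literature.Probability.LatticeModels.HexVertex); let finish : Literature.Probability.LatticeModels.DiscreteDobrushin → Literature.Probability.LatticeModels.HexVertex := fun E => match Literature.Probability.LatticeModels.explorationWalk E (∅ : Set (Literature.Probability.LatticeModels.Site 2)) with | some γ => γ.2.1 | none => (((0 : Literature.Probability.LatticeModels.Site 2), (0 :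 Fin 2)) : Literature.Probability.LatticeModels.HexVertex); let μ : ℝ → MeasureTheory.Measure (Literature.Probability.Percolation.SiteConfig (Literature.Probability.LatticeModels.Site 2)) := fun δ => Literature.Probability.RandomPlanarGeometry.tiltedExplorerMeasure (E δ) (Literature.Probability.RandomPlanarGeometry.triBoundaryWinding (E δ) (m δ)) (1 / 3) (g δ); ((∀ δ, (E δ).Ω = D.carrier) ∧ (∀ δ, (E δ).δ = δ) ∧ (∀ᶠ δ in nhdsWithin (0 : ℝ) (Set.Ioi 0), (E δ).IsAdmissible) ∧ Filter.Tendsto (fun δ : ℝ => (δ : ℂ) * Literature.Probability.LatticeModels.hexCenter (start (E δ))) (nhdsWithin 0 (Set.Ioi 0)) (nhds (D.pt 0)) ∧ Filter.Tendsto (fun δ : ℝ => (δ : ℂ) * Literature.Probability.LatticeModels.hexCenter (finish (E δ))) (nhdsWithin 0 (Set.Ioi 0)) (nhds (D.pt 1))) → (∀ᶠ δ in nhdsWithin (0 : ℝ) (Set.Ioi 0), (E δ).IsTwoChain) → Filter.Tendsto m (nhdsWithin (0 : ℝ) (Set.Ioi 0)) Filter.atTop → Filter.Tendsto (fun δ :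 ℝ => (m δ : ℝ) * δ) (nhdsWithin (0 : ℝ) (Set.Ioi 0)) (nhds 0) → (∀ δ, g δ ∈ Set.Icc (1 / 2 : ℝ) (3 / 2)) → Literature.Probability.RandomPlanarGeometry.IsTightAlongMesh (Ωδ := fun _ => Literature.Probability.Percolation.SiteConfig (Literature.Probability.LatticeModels.Site 2)) (fun δ => Literature.Probability.Percolation.triInterfaceIn D (E δ)) μ ∧ ∀ (φ : Literature.Probability.RandomPlanarGeometry.ConformalEquiv UpperHalfPlane.upperHalfPlaneSet D.carrier), D.IsChordalUniformizing φ → ∀ ν : MeasureTheory.Measure (Literature.Probability.RandomPlanarGeometry.CurveClass ℂ), MeasureTheory.IsProbabilityMeasure ν → Literature.Probability.RandomPlanarGeometry.IsSubseqLimitLaw (Ωδ := fun _ => Literature.Probability.Percolation.SiteConfig (Literature.Probability.LatticeModels.Site 2)) (fun δ => Literature.Probability.Percolation.triInterfaceIn D (E δ)) μ ν → ∀ᵐ c ∂ν, Literature.Probability.RandomPlanarGeometry.IsLoewnerDescribable φ c ∧ Literature.Probability.RandomPlanarGeometry.drivingFunction φ c 0 = 0 ∧ c.source = D.pt 0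

/-- item stmt-CriticalPhenomena-8022 · crux · rank 7 · open · by planner
why it might fail: As typed, c ↦ g_t(w) and τ^{w,m} must be measurable for the Integrable clause (else the hypothesis is unsatisfiable and the item vacuous); the far-field expansion needs the whole sector |w| > R (granted); W₀ = 0 + describability must supply Lévy's filtration.
sources: SchrammSheffield2005, MakarovSmirnov2010, MillerSheffield2016, arXiv:1201.1496, Lawler2005
[crux] (martingale characterisation of SLE_{8/3} by the imaginary-geometry harmonic function; the
continuum engine shared with cards imaginary-geometry-winding-dirichlet r4 and
turn-defect-kernel-orthogonality) let φ : ℍ → D be chordal uniformizing and ν a probability law on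
curve classes, ν-a.e. Loewner-describable through φ with driving function W, W₀ = 0, started at a.
For w ∈ ℍ put Z_t = g_t(w) − W_t and N^w_t := −(3/π)(arg Z_t − arg w) + (2/π)∫₀ᵗ Im(Z_s⁻²) ds (=
𝔥_t(φ(w)) − 𝔥₀(φ(w)) in units λ' = 1: 2λ/π = 3/π, 2χ = 2/π; the φ' terms cancel in increments),
stopped at τ^{w,m} = inf{t : |W_t| ≥ m or |Z_t| ≤ 1/(m+1)} ∧ m. If for some R and all w with |w| > R
the stopped N^{w,m} satisfy the martingale cylinder identities under ν (integrable, E[(N_{t∧τ} −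
N_{s∧τ}) ψ(W_{s₁..s_n})] = 0), then ν is the chordal SLE_{8/3} law in D. Proof route: far field N =
(3/π)Im(1/w)·W_t + (3/2π)Im(w⁻²)·(W_t² − (8/3)t) + O(|w|⁻³) uniformly under the stopping ⇒ W^{τ_m}
and (W² − 8t/3)^{τ_m} martingales ⇒ Lévy ⇒ `isSLELaw_of_isLocalMartingale_driving` with the κ ≠ 8
trace facts. [difficulty: L] -/
@[route_item "route-CriticalPhenomena-SAWTiltedExplorer"]
def WindingMartingaleIdentification : Prop :=
  ∀ (D : Literature.Probability.RandomPlanarGeometry.DobrushinDomain) (φ : Literature.Probability.RandomPlanarGeometry.ConformalEquiv UpperHalfPlane.upperHalfPlaneSet D.carrier) (ν : MeasureTheory.Measure (Literature.Probability.RandomPlanarGeometry.CurveClass ℂ)), let Wd : Literature.Probability.RandomPlanarGeometry.CurveClass ℂ → NNReal → ℝ := fun c => Literature.Probability.RandomPlanarGeometry.drivingFunction φ c; let Zf : ℂ → NNReal → Literature.Probability.RandomPlanarGeometry.CurveClass ℂ → ℂ := fun w t c => Literature.Probability.RandomPlanarGeometry.Loewner.map (Wd c) t w - (Wd c t : ℂ);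 let Nf : ℂ → NNReal → Literature.Probability.RandomPlanarGeometry.CurveClass ℂ → ℝ := fun w t c => -(3 / Real.pi) * (Complex.arg (Zf w t c) - Complex.arg w) + (2 / Real.pi) * ∫ s in (0 : ℝ)..(t : ℝ), ((Zf w s.toNNReal c)⁻¹ ^ 2).im; let τf : ℂ → ℕ → Literature.Probability.RandomPlanarGeometry.CurveClass ℂ → NNReal := fun w m c => sInf ({t : NNReal | (m : ℝ) ≤ |Wd c t| ∨ ‖Zf w t c‖ ≤ ((m : ℝ) + 1)⁻¹} ∪ {(m : NNReal)}); D.IsChordalUniformizing φ → MeasureTheory.IsProbabilityMeasure ν → (∀ᵐ c ∂ν, Literature.Probability.RandomPlanarGeometry.IsLoewnerDescribable φ c ∧ Literature.Probability.RandomPlanarGeometry.drivingFunction φ c 0 = 0 ∧ c.source = D.pt 0) → (∃ R : ℝ, ∀ w : ℂ, R < ‖w‖ → 0 < w.im → (∀ (m : ℕ) (s t : NNReal), s ≤ t → ∀ (n : ℕ) (S : Fin n → NNReal), (∀ k, S k ≤ s) → ∀ ψ : (Fin n → ℝ) → ℝ, Continuous ψ → (∀ v, |ψ v| ≤ 1)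 → MeasureTheory.Integrable (fun c => (Nf w (min t (τf w m c)) c - Nf w (min s (τf w m c)) c) * ψ (fun k => Wd c (S k))) ν ∧ ∫ c, (Nf w (min t (τf w m c)) c - Nf w (min s (τf w m c)) c) * ψ (fun k => Wd c (S k)) ∂ν = 0)) → Literature.Probability.RandomPlanarGeometry.IsSLELaw ((8 : NNReal) / 3) D ν

-- earlier BoundaryWindingData (stmt-CriticalPhenomena-8023, replaced 2026-08-15T16:55:17Z -> stmt-CriticalPhenomena-11270): retired by None — ∀ (D : Literature.Probability.RandomPlanarGeometry.DobrushinDomain) (E : ℝ → Literature.Probability.LatticeModels.DiscreteDobrushin), let Fc : Literature.Probability.LatticeModels.DiscreteDobrushin → Literature.Probability.Percolation.SiteConfig (Literature.Pr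
/-- item stmt-CriticalPhenomena-11270 · support · rank 9 · open · by planner
sources: MillerSheffield2016, Chelkak2016, SchrammSheffield2005
[support] (the boundary half of the data; construction — restated 2026-08-15: the former
uniform-integrability clause `H0^δ[β_δ²] locally bounded` is DROPPED, it contradicts (i) on every
Jordan domain whose boundary twists ω-a.e., e.g. the von Koch snowflake, where 𝔥₀ ∉ h²(D): refuter
note + evidence BoundaryWindingData_suspect_false.md on stmt-CriticalPhenomena-8023) for every
Dobrushin domain D and every admissible hexagonal discretisation family E_δ (domain D, mesh δ,
eventually admissible, start face → a, end face → b) there are boundary data β_δ on the two discrete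
arcs such that for every chordal uniformizing φ there is a continuous branch θ of arg φ'∘φ⁻¹ on D
with (i) the discrete harmonic extension H0^δ[β_δ] (SRW on Ω_δ ⊆ δ𝕋 absorbed on the arcs, which
cover ∂Ω_δ under admissibility) converging to 𝔥₀ = 3/2 − (3/π) arg φ⁻¹ + θ/π uniformly on compacts
(sup over lattice points of K → 0; no integrability of β_δ against discrete harmonic measure is
claimed), and (ii) the start gauge: π·(β_δ(x_a) + β_δ(y_b))/2 − θ(first examined hexagon) → 0 for
the two hexagons x_a ∈ A, y_b ∈ B of the first crossed edge. Intended witness: the lattice-intrinsic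
boundary winding read off the two b -/
@[route_item "route-CriticalPhenomena-SAWTiltedExplorer"]
def BoundaryWindingData : Prop :=
  ∀ (D : Literature.Probability.RandomPlanarGeometry.DobrushinDomain) (E : ℝ → Literature.Probability.LatticeModels.DiscreteDobrushin), let Fc : Literature.Probability.LatticeModels.DiscreteDobrushin → Literature.Probability.Percolation.SiteConfig (Literature.Probability.LatticeModels.Site 2) → ℕ → Literature.Probability.LatticeModels.HexVertex := fun E ω i => match Literature.Probability.LatticeModels.explorationWalk E ω with | some γ => γ.2.2.getVert i | none => (((0 : Literature.Probability.LatticeModels.Site 2), (0 : Fin 2)) : Literature.Probability.LatticeModels.HexVertex); let start : Literature.Probability.LatticeModels.DiscreteDobrushin → Literature.Probability.LatticeModels.HexVertex := fun E => match Literature.Probability.LatticeModels.explorationWalk E (∅ : Set (Literature.Probability.LatticeModels.Site 2)) with | some γ => γ.1 | none => (((0 : Literature.Probability.LatticeModels.Site 2), (0 : Fin 2)) : Literature.Probability.LatticeModels.HexVertex); let finish : Literature.Probability.LatticeModels.DiscreteDobrushin → Literature.Probability.LatticeModels.HexVertex := fun E => match Literature.Probability.LatticeModels.explorationWalk E (∅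 : Set (Literature.Probability.LatticeModels.Site 2)) with | some γ => γ.2.1 | none => (((0 : Literature.Probability.LatticeModels.Site 2), (0 : Fin 2)) : Literature.Probability.LatticeModels.HexVertex); let H0 : Literature.Probability.LatticeModels.DiscreteDobrushin → (Literature.Probability.LatticeModels.Site 2 → ℝ) → Literature.Probability.LatticeModels.Site 2 → ℝ := fun E β ζ => ∑' (u : Literature.Probability.LatticeModels.Site 2), ∑' (p : (Literature.Probability.LatticeModels.triDiscreteDomainGraph E.Ω E.δ).Walk ζ u), if u ∈ E.triArcA ∪ E.triArcB ∧ (∀ v ∈ p.support.dropLast, v ∉ E.triArcA ∪ E.triArcB) then (1 / 6 : ℝ) ^ p.length * β u else 0; ((∀ δ, (E δ).Ω = D.carrier) ∧ (∀ δ, (E δ).δ = δ) ∧ (∀ᶠ δ in nhdsWithin (0 : ℝ) (Set.Ioi 0), (E δ).IsAdmissible) ∧ Filter.Tendsto (fun δ : ℝ => (δ : ℂ) * Literature.Probability.LatticeModels.hexCenter (start (E δ))) (nhdsWithin 0 (Set.Ioi 0)) (nhds (D.pt 0)) ∧ Filter.Tendsto (fun δ : ℝ => (δ : ℂ) * Literature.Probability.LatticeModels.hexCenter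 (finish (E δ))) (nhdsWithin 0 (Set.Ioi 0)) (nhds (D.pt 1))) → ∃ β : ℝ → Literature.Probability.LatticeModels.Site 2 → ℝ, ∀ φ : Literature.Probability.RandomPlanarGeometry.ConformalEquiv UpperHalfPlane.upperHalfPlaneSet D.carrier, D.IsChordalUniformizing φ → ∃ θ : ℂ → ℝ, (ContinuousOn θ D.carrier ∧ ∀ z ∈ D.carrier, Complex.exp ((θ z : ℂ) * Complex.I) * (‖deriv (fun w : ℂ => φ w) (φ.symm z)‖ : ℂ) = deriv (fun w : ℂ => φ w) (φ.symm z)) ∧ (∀ K : Set ℂ, IsCompact K → K ⊆ D.carrier → Filter.Tendsto (fun δ : ℝ => ⨆ ζ ∈ {ζ : Literature.Probability.LatticeModels.Site 2 | Literature.Probability.LatticeModels.triMeshPoint δ ζ ∈ K}, ENNReal.ofReal |H0 (E δ) (β δ) ζ - (3 / 2 - 3 / Real.pi * Complex.arg (φ.symm (Literature.Probability.LatticeModels.triMeshPoint δ ζ)) + θ (Literature.Probability.LatticeModels.triMeshPoint δ ζ) / Real.pi)|) (nhdsWithin 0 (Set.Ioi 0)) (nhds 0)) ∧ Filter.Tendsto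 (fun δ : ℝ => Real.pi * ((∑ u ∈ Literature.Probability.LatticeModels.hexFaceVertices (Fc (E δ) ∅ 0) ∩ Literature.Probability.LatticeModels.hexFaceVertices (Fc (E δ) ∅ 1), β δ u) / 2) - ∑ u ∈ Literature.Probability.LatticeModels.hexFaceVertices (Fc (E δ) ∅ 1) \ Literature.Probability.LatticeModels.hexFaceVertices (Fc (E δ) ∅ 0), θ (Literature.Probability.LatticeModels.triMeshPoint δ u)) (nhdsWithin 0 (Set.Ioi 0)) (nhds 0)

/-- item stmt-CriticalPhenomena-8024 · support · rank 9 · open · by planner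
sources: SchrammSheffield2005, CamiaNewman2007, LawlerSchrammWerner2004SAW
[support] (typed shell of X, the shape the informal cruxes instantiate with μ_δ := the THE(g*)
colouring measure on data E_δ) for every Dobrushin domain and ℤ² endpoint approximation there are
discrete hexagonal Dobrushin data E_δ and probability measures μ_δ on hexagon colourings whose G02
exploration interfaces `triInterfaceIn D (E δ)` converge in law to chordal SLE_{8/3} in D (this is
(E)) and whose test integrals differ from those of the ℤ² x_c-SAW law by o(1) (this is (K) ∧ (U)).
As typed (∃) it carries no difficulty by itself (any SLE_{8/3}-convergent lattice-path family works
if the conjunct holds); it fixes the explorer shape of the assembly. [difficulty: provable-now] -/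
@[route_item "route-CriticalPhenomena-SAWTiltedExplorer", crux]
def TwinShell : Prop :=
  ∀ (D : Literature.Probability.RandomPlanarGeometry.DobrushinDomain) (a b : ℝ → Literature.Probability.LatticeModels.Site 2), Literature.Probability.RandomPlanarGeometry.SAW.IsEndpointApprox D a b → ∃ (E : ℝ → Literature.Probability.LatticeModels.DiscreteDobrushin) (μ : ℝ → MeasureTheory.Measure (Literature.Probability.Percolation.SiteConfig (Literature.Probability.LatticeModels.Site 2))), Literature.Probability.RandomPlanarGeometry.ConvergesInLawToSLE ((8 : NNReal) / 3) D (Ωδ := fun _ => Literature.Probability.Percolation.SiteConfig (Literature.Probability.LatticeModels.Site 2)) (fun δ => Literature.Probability.Percolation.triInterfaceIn D (E δ)) μ ∧ ∀ f : BoundedContinuousFunction (Literature.Probability.RandomPlanarGeometry.CurveClass ℂ) ℝ, Filter.Tendsto (fun δ => (∫ γ, f γ.curve ∂(Literature.Probability.RandomPlanarGeometry.SAW.law D.carrier δ (a δ) (b δ))) - ∫ ω, f (Literature.Probability.Percolation.triInterfaceIn D (E δ) ω) ∂(μ δ)) (nhdsWithin 0 (Set.Ioi 0)) (nhds 0)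

/-- item stmt-CriticalPhenomena-8025 · assembly · rank 1 · open · by planner
sources: LawlerSchrammWerner2004SAW, DuminilCopinSmirnov2012, SchrammSheffield2005
[assembly] TwinShell → SAWScalingLimit. -/
@[route_item "route-CriticalPhenomena-SAWTiltedExplorer", crux]
def Assembly : Prop :=
  TwinShell → SAWScalingLimit

/-! D-0027 §2.1 — DECIDING THEOREM (planner-authored via `route open/edit --closes-file`; by planner-rbadge-CriticalPhenomena-SAWTiltedExpl-70379fc9-g2-0 2026-08-15T16:23:05Z):
its hypotheses are this route's items and its conclusion the sub-problem Statement (glue_lint), and it elaborates with this file. -/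

@[closes "route-CriticalPhenomena-SAWTiltedExplorer"] theorem closes (hT : TwinShell) (hA : Assembly) : _root_.SAWScalingLimit :=
  hA hT

end Summit.CriticalPhenomena.SAWScalingLimit.Theses.SAWTiltedExplorer
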